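import Summits.ABC.IUTFork.Cor312Bridge
import Summits.ABC.IUTFork.Cor312EdgeAggregate
import Summits.ABC.IUTFork.Thm311RealLog
import HarnessLib

/-!
# Fork skeleton SCHEMA rows F-2618 / F-2776 / F-2222 — ∀-closures REFUTED, instances INHABITED

PROOF-ONLY companion (0 `def`, 0 `instance`, 0 notation; witnesses built inside the theorem terms) of the abc-iut cell,
block F (seat abc-iut-f-130, gen 7; director-abc g4 ROW SUPPLY `ROWS-LF-0348.tsv` «decide the label»), sequel to
`ForkSkeletonSchemaClosures.lean` (p495057) and `ForkSkeletonSchemaClosuresB.lean` (p495753). It imports — never edits —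
the files of record `Cor312Bridge` (`Cor312Vol.VerbatimDHAgreement`), `Cor312EdgeAggregate` (`Cor312Proof.AggCongruent`) and
`Thm311RealDH` / `Thm311RealLog` (`Thm311.Real.LogvLaw`, its inhabitant `Thm311.Real.exists_logvLaw` BY NAME).

Each row is a PARAMETRISED `Prop` over a FREE signature (two `Cor312Setting`s; a finite family of `Cor312Setting`s; a family
`logv : PadicLogs F` of abstract logarithms); per row this file records the two CLOSED statements the kernel can make:
`not_forall_<decl>` (universal closure FALSE at a junk datum — SCHEMA-REFUTED) and `exists_<decl>` (INHABITED).

Witnesses: the two settings over `ForkRegions.witnessContainer` (carrier `ℕ`, `ln ν̄(A) = 𝟙_A(0) + 𝟙_A(1)`, hull = identity)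
with `(U, Q) = ({0}, {0,1})` resp. `({0,1}, {0})` (their `−|log(q)|` are `2 ≠ 1`; in the first, every region inside the hull
`{0}` has `ln ν̄ ≤ 1 < 2`; in the second `Q` itself is a congruent sub-region of the hull); and, for `LogvLaw`, the DEGENERATE
family `logv := 0` over `F = ℚ` that the docstring of `LogvLaw` itself names as excluded: its log-shell at any finite place is
`{0}`, which does not contain `1 ∈ O_v`.

HONEST FRAMING: a refuted ∀-closure says only that the SCHEMA over the free signature is not a theorem at junk data; it says
nothing about any curve, about [IUTchIII] Cor. 3.12 / Thm. 3.11, [IUTchIV], Dupuy–Hilado or Yamashita's Cor. 13.13, and takes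
no side on any author. A FACT row is an assumption label on OUR typed statement; typed ≠ proved.
[claim: Mochizuki2012, status: disputed] [cite: DupuyHilado2025, §1 pp. 3–4]
-/

noncomputable section

namespace Summit.ABC

namespace IUTFork

namespace SchemaClosures

open Literature.IUT.LogThetaLattice

/-! ## The two witness settings over `ForkRegions.witnessContainer`, as existence theorems -/

/-- The log-volume of `ForkRegions.witnessContainer` on `A ⊆ ℕ` is `𝟙_A(0) + 𝟙_A(1)`. [folklore] -/
private theorem witnessContainer_logvol (A : Set ℕ) :
    witnessContainer.logvol A = A.indicator (fun _ => (1 : ℝ)) 0 + A.indicator (fun _ => (1 : ℝ)) 1 := rfl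

/-- **The BAD witness setting**: a `Cor312Setting` with `−|log(q)| = 2` in which every admissible region inside the
holomorphic hull has log-volume `≤ 1` (over `witnessContainer`: `U = {0}`, hull = identity, `Q = {0, 1}`). [folklore] -/
theorem exists_badSetting :
    ∃ C : Cor312Setting, C.negAbsLogq = 2 ∧ ∀ R : Set C.L, R ⊆ C.Uhol → C.logvol R ≤ 1 := by
  let C : Cor312Setting :=
    { toVolumeContainer := witnessContainer, Idx := Unit, U := fun _ => ({0} : Set ℕ), U_adm := fun _ => trivial,
      Uhol_adm := trivial, Q := ({0, 1} : Set ℕ), Q_adm := trivial }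
  have hhol : C.Uhol = ({0} : Set ℕ) := by
    show ClosureOperator.id (Set ℕ) (⋃ _ : Unit, ({0} : Set ℕ)) = {0}
    rw [Set.iUnion_const]
    rfl
  refine ⟨C, ?_, fun R hR => ?_⟩
  · show witnessContainer.logvol ({0, 1} : Set ℕ) = 2
    rw [witnessContainer_logvol]
    simp only [Set.indicator_apply, Set.mem_insert_iff, Set.mem_singleton_iff]
    norm_num
  · rw [hhol] at hR
    have h1 : (1 : ℕ) ∉ R := fun h1 => by have h01 : (1 : ℕ) ∈ ({0} : Set ℕ) := hR h1; simp at h01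
    show witnessContainer.logvol R ≤ 1
    rw [witnessContainer_logvol, Set.indicator_of_notMem h1, add_zero]
    by_cases h0 : (0 : ℕ) ∈ R
    · rw [Set.indicator_of_mem h0]
    · rw [Set.indicator_of_notMem h0]; norm_num

/-- **The GOOD witness setting**: a `Cor312Setting` with `−|log(q)| = 1` whose `q`-pilot image is itself an admissible
region of the hull (over `witnessContainer`: `U = {0, 1}`, `Q = {0}`). [folklore] -/
theorem exists_goodSetting :
    ∃ C : Cor312Setting, C.negAbsLogq = 1 ∧ C.Q ⊆ C.Uhol := by
  let C : Cor312Setting :=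
    { toVolumeContainer := witnessContainer, Idx := Unit, U := fun _ => ({0, 1} : Set ℕ), U_adm := fun _ => trivial,
      Uhol_adm := trivial, Q := ({0} : Set ℕ), Q_adm := trivial }
  have hhol : C.Uhol = ({0, 1} : Set ℕ) := by
    show ClosureOperator.id (Set ℕ) (⋃ _ : Unit, ({0, 1} : Set ℕ)) = {0, 1}
    rw [Set.iUnion_const]
    rfl
  refine ⟨C, ?_, ?_⟩
  · show witnessContainer.logvol ({0} : Set ℕ) = 1
    rw [witnessContainer_logvol]
    simp only [Set.indicator_apply, Set.mem_singleton_iff]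
    norm_num
  · rw [hhol]
    show ({0} : Set ℕ) ⊆ {0, 1}
    simp

/-! ## F-2618 `Cor312Vol.VerbatimDHAgreement` (the verbatim ↔ Dupuy–Hilado identifications) -/

/-- **F-2618, ∀-closure REFUTED**: two `Cor312Setting`s with `−|log(q)|` equal to `2` resp. `1` do not satisfy
`VerbatimDHAgreement` (its `q_logvol` clause fails). (Instance/structural forms by name: `VerbatimDHAgreement.refl/symm/trans`.)
[cite: DupuyHilado2025, §1 pp. 3–4] -/
theorem not_forall_verbatimDHAgreement : ¬ ∀ Cv Cd : Cor312Setting, Cor312Vol.VerbatimDHAgreement Cv Cd := by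
  intro h
  obtain ⟨Cv, hv, -⟩ := exists_badSetting
  obtain ⟨Cd, hd, -⟩ := exists_goodSetting
  have := (h Cv Cd).q_logvol
  rw [hv, hd] at this
  norm_num at this

/-- **F-2618, INHABITED**: every setting agrees with itself (`VerbatimDHAgreement.refl`). [cite: DupuyHilado2025, §1 pp. 3–4] -/
theorem exists_verbatimDHAgreement : ∃ Cv Cd : Cor312Setting, Cor312Vol.VerbatimDHAgreement Cv Cd :=
  ⟨witnessSetting, witnessSetting, Cor312Vol.VerbatimDHAgreement.refl _⟩

/-! ## F-2776 `Cor312Proof.AggCongruent` (Reading 4, aggregate form over a finite family of settings) -/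

/-- **F-2776, ∀-closure REFUTED**: for the one-member family consisting of the bad witness setting, no admissible
sub-region of the hull has log-volume equal to the aggregate `−|log(q)| = 2` (all such log-volumes are `≤ 1`).
(Conditional forms by name: `aggCongruent_of_componentwise`, `aggCongruent_of_aggCor312_of_ivt_at`.)
[cite: Yamashita2024IUTSurvey, Cor. 13.13 proof p. 360 ll. 30–40] -/
theorem not_forall_aggCongruent :
    ¬ ∀ (ι : Type) [Fintype ι] (C : ι → Cor312Setting), Cor312Proof.AggCongruent C := by
  intro h
  obtain ⟨C, hq, hle⟩ := exists_badSetting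
  obtain ⟨R, hR, hsum⟩ := h Unit (fun _ => C)
  simp only [Cor312Proof.aggNegAbsLogq, Finset.univ_unique, Finset.sum_singleton] at hsum
  have := hle (R default) (hR default).2
  rw [hsum, hq] at this
  norm_num at this

/-- **F-2776, INHABITED**: for the one-member family consisting of the good witness setting, `R := Q` is an admissible
sub-region of the hull with the aggregate `q`-log-volume. [cite: Yamashita2024IUTSurvey, Cor. 13.13 proof p. 360 ll. 30–40] -/
theorem exists_aggCongruent :
    ∃ (ι : Type) (_ : Fintype ι) (C : ι → Cor312Setting), Cor312Proof.AggCongruent C := by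
  obtain ⟨C, -, hQ⟩ := exists_goodSetting
  refine ⟨Unit, inferInstance, fun _ => C, fun _ => C.Q, fun _ => ⟨C.Q_adm, hQ⟩, ?_⟩
  simp [Cor312Proof.aggNegAbsLogq, Cor312Setting.negAbsLogq]

/-! ## F-2222 `Thm311.Real.LogvLaw` (`O_v ⊆ I_v` for a family of abstract `p_v`-adic logarithms) -/

open NumberField IsDedekindDomain in
/-- **F-2222, ∀-closure REFUTED**: over `F = ℚ` the degenerate family `logv := 0` (named as excluded in the docstring of
`LogvLaw`) violates the law: at any finite place `v` its log-shell `(p_v^*)⁻¹ · 0(O_v^×) = {0}` does not contain `1 ∈ O_v`.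
[claim: Mochizuki2012, status: disputed] -/
theorem not_forall_logvLaw :
    ¬ ∀ (F : Type) [Field F] [NumberField F] (logv : Thm311.Real.PadicLogs F), Thm311.Real.LogvLaw logv := by
  intro h
  -- a finite place of ℚ
  obtain ⟨M, hM⟩ := Ideal.exists_maximal (𝓞 ℚ)
  let v : HeightOneSpectrum (𝓞 ℚ) :=
    ⟨M, hM.isPrime, Ring.ne_bot_of_isMaximal_of_not_isField hM (RingOfIntegers.not_isField ℚ)⟩
  have hlaw := (h ℚ 0 v).subset
  have h1 : (1 : Thm311.Real.Carrier (.inr v : Thm311.Real.Place ℚ)) ∈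
      (Thm311.Real.integers (F := ℚ) v : Set (Thm311.Real.Carrier (.inr v : Thm311.Real.Place ℚ))) :=
    (Thm311.Real.integers (F := ℚ) v).one_mem
  obtain ⟨x, hx⟩ := hlaw h1
  simp only [Pi.zero_apply, AddMonoidHom.zero_apply, mul_zero] at hx
  exact one_ne_zero hx

/-- **F-2222, INHABITED**: over every number field a law-abiding family exists — the analytic `p_v`-adic logarithms
(`Thm311.Real.exists_logvLaw`, by name; here at `F = ℚ`). [claim: Mochizuki2012, status: disputed] -/
theorem exists_logvLaw : ∃ logv : Thm311.Real.PadicLogs ℚ, Thm311.Real.LogvLaw logv :=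
  Thm311.Real.exists_logvLaw ℚ

end SchemaClosures

end IUTFork

end Summit.ABC

end
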